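import Literature.AnabelianGeometry.AbsoluteAnabelian.DiagramMorphisms
import Mathlib.CategoryTheory.Equivalence

/-!
# Rigid functors and id-rigid categories: transport lemmas ([AbsTopIII] §0 "Categories")

Proof-only toolkit (kind=proof; no new notions) over seat abc-iut-L4-t2's honest definitions
`IsRigidFunctor` / `IsIdRigid` (`DiagramMorphisms.lean`) of S. Mochizuki, *Topics in absolute
anabelian geometry III*, §0 p.27 (bib key `MochizukiAbsTopIII2015`; locators = kurims manuscript
pages, lit key `paper:url-5493eb38cbb7`): "a functor `φ : 𝒞 → 𝒞'` is rigid if every automorphism of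
`φ` is equal to the identity; if the identity functor of `𝒞` is rigid, then we shall say that `𝒞` is
id-rigid".  The lemmas are the elementary closure properties every use of rigidity in Def 3.5
(v)/(vi) and Cor 3.6 (v) / Cor 3.7 (v) / Cor 4.5 (v) (total `□`-rigidity) silently relies on:

* `isRigidFunctor_of_iso` — rigidity is invariant under isomorphism of functors (e.g. `𝔩𝔬𝔤 ≅ 𝟭`,
  Prop 3.2 (v), transports the id-rigidity of `𝒞^{MLF-sB}_T` (Prop 3.2 (iv)) to `𝔩𝔬𝔤`);
* `isRigidFunctor_of_comp_faithful` — if `F ⋙ G` is rigid and `G` is faithful then `F` is rigid;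
* `isRigidFunctor_of_essSurj_precomp` — if `G ⋙ F` is rigid and `G` is essentially surjective then
  `F` is rigid (used with the diagonal `δ_𝒳 : 𝒳 → 𝒳 ×_𝔈 𝒳` of Cor 3.7, an equivalence);
* `isIdRigid_of_equivalence` — id-rigidity is invariant under equivalence of categories (so
  `𝒳 ×_𝔈 𝒳 ≃ 𝒳` is id-rigid as soon as `𝒳` is).

Refereed pre-IUT category theory; nothing here bears on [IUTchIII] Cor 3.12.
-/

namespace Literature.AnabelianGeometry.AbsoluteAnabelian

open _root_.CategoryTheory

universe v u v' u'

section Rigid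

variable {C : Type u} [Category.{v} C] {C' : Type u} [Category.{v} C'] {C'' : Type u}
  [Category.{v} C'']

/-- A functor isomorphic to a rigid functor is rigid: automorphisms of `G` correspond to
automorphisms of `F ≅ G` under conjugation by the isomorphism.
[cite: MochizukiAbsTopIII2015, Section 0 p.27] -/
theorem isRigidFunctor_of_iso {F G : C ⥤ C'} (e : F ≅ G) (hF : IsRigidFunctor F) :
    IsRigidFunctor G := by
  intro β
  have h := hF (e ≪≫ β ≪≫ e.symm)
  have : β = e.symm ≪≫ (e ≪≫ β ≪≫ e.symm) ≪≫ e := by ext x; simp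
  rw [this, h]
  ext x
  simp

/-- Rigidity is invariant under isomorphism of functors.
[cite: MochizukiAbsTopIII2015, Section 0 p.27] -/
theorem isRigidFunctor_congr {F G : C ⥤ C'} (e : F ≅ G) : IsRigidFunctor F ↔ IsRigidFunctor G :=
  ⟨isRigidFunctor_of_iso e, isRigidFunctor_of_iso e.symm⟩

/-- A rigid functor has only the identity automorphism, componentwise.
[cite: MochizukiAbsTopIII2015, Section 0 p.27] -/
theorem IsRigidFunctor.hom_app_eq_id {F : C ⥤ C'} (hF : IsRigidFunctor F) (α : F ≅ F) (x : C) :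
    α.hom.app x = 𝟙 (F.obj x) := by
  rw [hF α]
  rfl

/-- A functor all of whose automorphisms have identity components is rigid.
[cite: MochizukiAbsTopIII2015, Section 0 p.27] -/
theorem isRigidFunctor_of_hom_app_eq_id {F : C ⥤ C'}
    (h : ∀ (α : F ≅ F) (x : C), α.hom.app x = 𝟙 (F.obj x)) : IsRigidFunctor F := by
  intro α
  ext x
  rw [h α x]
  rfl

/-- If `F ⋙ G` is rigid and `G` is faithful, then `F` is rigid (whisker an automorphism of `F`
with `G`). [cite: MochizukiAbsTopIII2015, Section 0 p.27] -/
theorem isRigidFunctor_of_comp_faithful {F : C ⥤ C'} {G : C' ⥤ C''} [G.Faithful]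
    (h : IsRigidFunctor (F ⋙ G)) : IsRigidFunctor F := by
  refine isRigidFunctor_of_hom_app_eq_id fun α x => G.map_injective ?_
  have h1 := h.hom_app_eq_id (Functor.isoWhiskerRight α G) x
  rw [Functor.isoWhiskerRight_hom, Functor.whiskerRight_app] at h1
  rw [h1, G.map_id]
  rfl

/-- If `G ⋙ F` is rigid and `G` is essentially surjective, then `F` is rigid: an automorphism of
`F` that is trivial on the objects `G c` is trivial everywhere, by naturality along isomorphisms
`G c ≅ x`. [cite: MochizukiAbsTopIII2015, Section 0 p.27] -/
theorem isRigidFunctor_of_essSurj_precomp {G : C ⥤ C'} {F : C' ⥤ C''} [G.EssSurj]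
    (h : IsRigidFunctor (G ⋙ F)) : IsRigidFunctor F := by
  refine isRigidFunctor_of_hom_app_eq_id fun α x => ?_
  have h1 := h.hom_app_eq_id (Functor.isoWhiskerLeft G α) (G.objPreimage x)
  rw [Functor.isoWhiskerLeft_hom, Functor.whiskerLeft_app] at h1
  have nat := α.hom.naturality (G.objObjPreimageIso x).hom
  rw [h1] at nat
  erw [Category.id_comp] at nat
  exact (cancel_epi (F.map (G.objObjPreimageIso x).hom)).1 (nat.trans (Category.comp_id _).symm)

end Rigid

section IdRigid

variable {C : Type u} [Category.{v} C] {D : Type u} [Category.{v} D]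

/-- **Id-rigidity is invariant under equivalence of categories**: if `C ≌ D` and `D` is id-rigid,
so is `C`.  (The composite `e.inverse ⋙ e.functor ≅ 𝟭_D` is rigid; `e.inverse` is essentially
surjective, so `e.functor ≅ 𝟭_C ⋙ e.functor` is rigid; `e.functor` is faithful, so `𝟭_C` is rigid.)
[cite: MochizukiAbsTopIII2015, Section 0 p.27] -/
theorem isIdRigid_of_equivalence (e : C ≌ D) (hD : IsIdRigid D) : IsIdRigid C :=
  isRigidFunctor_of_comp_faithful (G := e.functor)
    (isRigidFunctor_of_iso e.functor.leftUnitor.symm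
      (isRigidFunctor_of_essSurj_precomp (G := e.inverse)
        (isRigidFunctor_of_iso e.counitIso.symm hD)))

/-- Id-rigidity transfers forward along an equivalence as well.
[cite: MochizukiAbsTopIII2015, Section 0 p.27] -/
theorem isIdRigid_of_equivalence' (e : C ≌ D) (hC : IsIdRigid C) : IsIdRigid D :=
  isIdRigid_of_equivalence e.symm hC

/-- A **fully faithful** functor out of an id-rigid category is rigid: an automorphism of `F`
lifts (fullness) to a family of automorphisms in `C`, natural by faithfulness, i.e. to an
automorphism of `𝟭_C`, which is trivial — e.g. the diagonal `δ_𝒳 : 𝒳 → 𝒳 ×_𝔈 𝒳` and the projection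
`π_𝒳` of Cor 3.7 (ii), both equivalences. [cite: MochizukiAbsTopIII2015, Section 0 p.27] -/
theorem isRigidFunctor_of_full_faithful (F : C ⥤ D) [F.Full] [F.Faithful] (hC : IsIdRigid C) :
    IsRigidFunctor F := by
  refine isRigidFunctor_of_hom_app_eq_id fun α x => ?_
  let β : 𝟭 C ≅ 𝟭 C := NatIso.ofComponents (fun y => F.preimageIso (α.app y))
    (fun {y z} f => F.map_injective (by simp))
  have hβ := hC.hom_app_eq_id β x
  simp only [β, NatIso.ofComponents_hom_app, Functor.preimageIso_hom, Iso.app_hom] at hβ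
  have hβ' : F.preimage (α.hom.app x) = 𝟙 x := hβ
  calc α.hom.app x = F.map (F.preimage (α.hom.app x)) := (F.map_preimage _).symm
    _ = 𝟙 (F.obj x) := by rw [hβ', F.map_id]

end IdRigid

end Literature.AnabelianGeometry.AbsoluteAnabelian
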